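import Literature.NumberTheory.Automorphic.UnitaryGroupPureTensorIntegral
import Literature.NumberTheory.Automorphic.AdicCompletionCompact
import Literature.MeasureTheory.RestrictedProduct.ProductIntegral
import Literature.MeasureTheory.RestrictedProduct.Haar
import HarnessLib

/-!
# Integrals of pure tensors on `U(H)(𝔸_{L⁺})`, II: the Euler product of the finite-adelic factor

Topic `NumberTheory/Automorphic`; namespace `Literature.NumberTheory.Automorphic.UnitaryGroup`. THEOREMS ONLY
(no definition, no instance, no named fact, no `sorry`).

Sequel of `UnitaryGroupPureTensorIntegral` (the `∞ ⊔ f` split). Here the FINITE-ADELIC FACTOR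
`Λ(b) = 1_{∀ v ∉ S, b_v ∈ U(H)(𝒪_v)} · ∏_{v∈S} f_v(b_v)` of a factorizable function on
`U(H)(𝔸_{L⁺,f}) = ∏'_v (U(H)(L⁺_v) : U(H)(𝒪_v))` (★ `finAdelicEquiv`, `UnitaryGroupRestrictedProduct`) is integrated
against a Haar measure `μ_f`: with local Haar measures `m_v` on `U(H)(L⁺_v)` normalised by `m_v(U(H)(𝒪_v)) = 1`
(★ `cmLocalIntegralLevel`),

  `∫ Λ dμ_f = κ_f · ∏_{v ∈ S} ∫ f_v dm_v`,   `κ_f = μ_f(∏_v U(H)(𝒪_v)) > 0`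

(`exists_integral_finFactor_eq_mul_prod`): transport `μ_f` to the restricted product, where it is `κ_f` times the
restricted product of the `m_v` (★ `eq_smul_rpMeasure`, Tate's `dα = ∏ dα_𝔭`), and apply the Euler factorisation of
cylinder product integrals (★ `integral_indicator_rpBox_prod`). Combined with part I:
**`exists_integral_eval_eq_mul_integral_arch_mul_prod`** — for every pure tensor `T` with integral levels off its
bad set, `∫_{U(H)(𝔸)} T.eval dν = κ · (∫ f_∞ dμ_∞) · ∏_{v ∈ T.S} ∫ f_v dm_v` with ONE `κ > 0` (Borel–Jacquet (1979)
§4.1; the factorisation behind [Rogawski1990] §14.2's comparison of `f′ = ⊗ f′_v` and `f = ⊗ f_v`).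

Also proved here (used for the transport): `GL_N(E_w)` and the factor `U(J)(F_v) ≤ ∏_{w∣v} GL_N(E_w)` are second
countable and locally compact (`secondCountableTopology_localPi`, `locallyCompactSpace_localPi`).

Written for the cell `pub/hodgecm-mathlib`, ENGINE T1 line `F0_T1InnerFormTraceIdentity` (brick B13). HC_CM is proved
only modulo the printed citations until rung 0 closes; this file is unconditional.

## References

* A. Borel, H. Jacquet, *Automorphic forms and automorphic representations*, PSPM 33.1 (1979), §4.1 [BorelJacquet1979].
* J. W. S. Cassels, A. Fröhlich (eds.), *Algebraic Number Theory* (1967), Ch. XV (Tate), §3.3 [CasselsFrohlichANT1967].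
-/

noncomputable section

open MeasureTheory NumberField IsDedekindDomain Set Filter
open scoped NNReal ENNReal RestrictedProduct

namespace Literature.NumberTheory.Automorphic.UnitaryGroup

open Literature.MeasureTheory.RestrictedProduct

/-! ### Topology of the local factors -/

section Local

variable (E : Type) [Field E] [NumberField E] (N : ℕ)

/-- `GL_N(E_w)` is second countable. [cite: BorelJacquet1979, §4.1] -/
theorem secondCountableTopology_gl_adicCompletion (w : HeightOneSpectrum (𝓞 E)) :
    SecondCountableTopology (GL (Fin N) (w.adicCompletion E)) := by
  haveI := secondCountableTopology_adicCompletion E w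
  haveI : SecondCountableTopology (Matrix (Fin N) (Fin N) (w.adicCompletion E)) :=
    inferInstanceAs (SecondCountableTopology (Fin N → Fin N → w.adicCompletion E))
  haveI : SecondCountableTopology (Matrix (Fin N) (Fin N) (w.adicCompletion E))ᵐᵒᵖ :=
    MulOpposite.opHomeomorph.symm.secondCountableTopology
  exact Units.isEmbedding_embedProduct.secondCountableTopology

/-- `GL_N(E_w)` is locally compact. [cite: BorelJacquet1979, §4.1] -/
theorem locallyCompactSpace_gl_adicCompletion (w : HeightOneSpectrum (𝓞 E)) :
    LocallyCompactSpace (GL (Fin N) (w.adicCompletion E)) := by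
  haveI := locallyCompactSpace_adicCompletion E w
  haveI : LocallyCompactSpace (Matrix (Fin N) (Fin N) (w.adicCompletion E)) :=
    inferInstanceAs (LocallyCompactSpace (Fin N → Fin N → w.adicCompletion E))
  haveI : LocallyCompactSpace (Matrix (Fin N) (Fin N) (w.adicCompletion E))ᵐᵒᵖ :=
    MulOpposite.opHomeomorph.symm.isClosedEmbedding.locallyCompactSpace
  exact Units.isClosedEmbedding_embedProduct.locallyCompactSpace

variable (F : Type) [Field F] [NumberField F] [Algebra F E] (c : E ≃ₐ[F] E) (J : Matrix (Fin N) (Fin N) E)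

variable {F} in
/-- The factor `U(J)(F_v) ≤ ∏_{w ∣ v} GL_N(E_w)` is second countable. [cite: BorelJacquet1979, §4.1] -/
theorem secondCountableTopology_localPi (v : HeightOneSpectrum (𝓞 F)) :
    SecondCountableTopology (localPi E c N J v) := by
  haveI := fun w : PlacesOver E v => secondCountableTopology_gl_adicCompletion E N w.1
  exact TopologicalSpace.Subtype.secondCountableTopology _

variable {F} in
/-- The factor `U(J)(F_v)` is locally compact (closed in `∏_{w ∣ v} GL_N(E_w)`, ★ `isClosed_localPi`).
[cite: BorelJacquet1979, §4.1] -/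
theorem locallyCompactSpace_localPi (v : HeightOneSpectrum (𝓞 F)) : LocallyCompactSpace (localPi E c N J v) := by
  haveI := fun w : PlacesOver E v => locallyCompactSpace_gl_adicCompletion E N w.1
  exact (isClosed_localPi E c N J v).isClosedEmbedding_subtypeVal.locallyCompactSpace

end Local

/-! ### The Euler product of the finite-adelic factor -/

section CM

variable {L : Type} [Field L] [NumberField L] [IsCMField L] {N : ℕ} {H : Matrix (Fin N) (Fin N) L}

/-- **Euler factorisation of the finite-adelic factor.** Let `μ_f` be a Haar measure on `U(H)(𝔸_{L⁺,f})` and `m_v`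
Haar measures on the `U(H)(L⁺_v)` normalised by `m_v(U(H)(𝒪_v)) = 1` for every finite `v`. There is one
`κ_f > 0` (namely `μ_f` of the integral level `∏_v U(H)(𝒪_v)`) such that for every finite set `S` of finite places
and all `f_v : U(H)(L⁺_v) → ℂ`,
`∫ 1_{∀ v ∉ S, b_v ∈ U(H)(𝒪_v)} ∏_{v∈S} f_v(b_v) dμ_f(b) = κ_f · ∏_{v∈S} ∫ f_v dm_v` (no integrability hypotheses).
[cite: BorelJacquet1979, §4.1] [cite: CasselsFrohlichANT1967, Ch. XV (Tate) §3.3, PDF pp. 352–353] -/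
theorem exists_integral_finFactor_eq_mul_prod
    [MeasurableSpace (finAdelic (↥(maximalRealSubfield L)) L (IsCMField.complexConj L) N H)]
    [BorelSpace (finAdelic (↥(maximalRealSubfield L)) L (IsCMField.complexConj L) N H)]
    [∀ v, MeasurableSpace ((cmDatum L N H).Local v)] [∀ v, BorelSpace ((cmDatum L N H).Local v)]
    (μf : Measure (finAdelic (↥(maximalRealSubfield L)) L (IsCMField.complexConj L) N H)) [μf.IsHaarMeasure]
    (m : ∀ v, Measure ((cmDatum L N H).Local v)) [∀ v, (m v).IsHaarMeasure]
    (hm : ∀ v, m v (cmLocalIntegralLevel L N H v) = 1) :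
    ∃ κ : ℝ, 0 < κ ∧ ∀ (S : Finset (HeightOneSpectrum (𝓞 ↥(maximalRealSubfield L))))
      (f : ∀ v, (cmDatum L N H).Local v → ℂ),
      ∫ b, {b : finAdelic (↥(maximalRealSubfield L)) L (IsCMField.complexConj L) N H |
          ∀ v ∉ S, evalPlace (↥(maximalRealSubfield L)) L (IsCMField.complexConj L) N H v b ∈
            localInt L (IsCMField.complexConj L) N H v}.indicator
        (fun b => ∏ v ∈ S, f v (localPiEquiv L (IsCMField.complexConj L) N H v
          (evalPlace (↥(maximalRealSubfield L)) L (IsCMField.complexConj L) N H v b))) b ∂μf =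
        (κ : ℂ) * ∏ v ∈ S, ∫ x, f v x ∂(m v) := by
  classical
  -- shorthands for the factor data
  let c := IsCMField.complexConj L
  let G : HeightOneSpectrum (𝓞 ↥(maximalRealSubfield L)) → Type := fun v => ↥(localPi L c N H v)
  let B : ∀ v, Subgroup (G v) := fun v => localInt L c N H v
  let ψ : ∀ v, G v ≃ₜ* (cmDatum L N H).Local v := fun v => localPiEquiv L c N H v
  -- instances on the factors
  haveI : ∀ v, SecondCountableTopology (G v) := fun v => secondCountableTopology_localPi L N c H v
  haveI : ∀ v, LocallyCompactSpace (G v) := fun v => locallyCompactSpace_localPi L N c H v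
  letI : ∀ v, MeasurableSpace (G v) := fun v => borel _
  haveI : ∀ v, BorelSpace (G v) := fun v => ⟨rfl⟩
  haveI : Countable (HeightOneSpectrum (𝓞 ↥(maximalRealSubfield L))) :=
    countable_heightOneSpectrum ↥(maximalRealSubfield L)
  have hBo : ∀ v, IsOpen (B v : Set (G v)) := fun v => isOpen_localInt L c N H v
  have hBm : ∀ v, MeasurableSet (B v : Set (G v)) := fun v => (hBo v).measurableSet
  have hBcpt : ∀ v, IsCompact (B v : Set (G v)) := fun v => isCompact_localInt L c N H v
  -- the local measures on the factor carriers
  let ν' : ∀ v, Measure (G v) := fun v => (m v).map (ψ v).symm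
  haveI : ∀ v, (ν' v).IsHaarMeasure := fun v => (ψ v).symm.isHaarMeasure_map (m v)
  have hpre : ∀ v, (ψ v).symm ⁻¹' (B v : Set (G v)) = (cmLocalIntegralLevel L N H v : Set _) := by
    intro v
    ext x
    exact localPiEquiv_symm_mem_localInt_iff c N H v x
  have hB1 : ∀ v, v ∉ (∅ : Finset _) → ν' v (B v : Set (G v)) = 1 := by
    intro v _
    change ((m v).map (ψ v).symm) (B v : Set (G v)) = 1
    rw [Measure.map_apply (map_continuous (ψ v).symm).measurable (hBm v), hpre v]
    exact hm v
  have hBc : ∀ v, v ∉ (∅ : Finset _) → IsCompact (B v : Set (G v)) := fun v _ => hBcpt v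
  -- the restricted product and the transported Haar measure
  haveI : BorelSpace (Πʳ v, [G v, B v]) := borelSpace (fun v => (B v : Set (G v))) hBm
  haveI : SecondCountableTopology (Πʳ v, [G v, B v]) := secondCountableTopology (fun v => (B v : Set (G v))) hBo
  haveI : LocallyCompactSpace (Πʳ v, [G v, B v]) :=
    RestrictedProduct.locallyCompactSpace_of_group _ (Eventually.of_forall hBcpt)
  haveI := locallyCompactSpace_finAdelic (↥(maximalRealSubfield L)) L c N H
  haveI := secondCountableTopology_finAdelic (↥(maximalRealSubfield L)) L c N H
  let e : finAdelic (↥(maximalRealSubfield L)) L c N H ≃ₜ* (Πʳ v, [G v, B v]) :=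
    finAdelicEquiv (↥(maximalRealSubfield L)) L c N H
  let μ' : Measure (Πʳ v, [G v, B v]) := μf.map e
  haveI : μ'.IsHaarMeasure := e.isHaarMeasure_map μf
  -- positive compacts `C v = U(H)(𝒪_v)` (used by the uniqueness transfer only)
  let Cv : ∀ v, TopologicalSpace.PositiveCompacts (G v) := fun v =>
    { carrier := (B v : Set (G v))
      isCompact' := hBcpt v
      interior_nonempty' := by
        rw [(hBo v).interior_eq]
        exact ⟨1, (B v).one_mem⟩ }
  -- Haar uniqueness on the restricted product: `μ' = κ • ∏' (ν'_v ; B_v)` with `0 < κ < ∞`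
  obtain ⟨κ, hκpos, hκtop, key⟩ : ∃ κ : ℝ≥0∞, κ ≠ 0 ∧ κ ≠ ⊤ ∧
      μ' = κ • rpMeasure (fun v => (B v : Set (G v))) ν' ∅ := by
    refine ⟨_, ?_, ?_, eq_smul_rpMeasure B ∅ Cv ν' hBc hB1 μ'⟩
    · exact mul_ne_zero (Measure.measure_pos_of_nonempty_interior μ' (haarBox_interior_nonempty B ∅ Cv)).ne'
        (ENNReal.inv_ne_zero.2 (prod_haar_ne_top ∅ Cv ν'))
    · exact ENNReal.mul_ne_top (isCompact_haarBox B ∅ Cv hBc).measure_lt_top.ne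
        (ENNReal.inv_ne_top.2 (prod_haar_ne_zero ∅ Cv ν'))
  refine ⟨κ.toReal, ENNReal.toReal_pos hκpos hκtop, fun S f => ?_⟩
  -- the integrand on the restricted product side
  let Λ' : (Πʳ v, [G v, B v]) → ℂ := fun x =>
    (rpBox (fun v => (B v : Set (G v))) S).indicator
      (fun x => ∏ i : {i // i ∈ S}, f i.1 (ψ i.1 (x i.1))) x
  have hΛ : ∀ b, {b : finAdelic (↥(maximalRealSubfield L)) L c N H |
        ∀ v ∉ S, evalPlace (↥(maximalRealSubfield L)) L c N H v b ∈ localInt L c N H v}.indicator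
      (fun b => ∏ v ∈ S, f v (localPiEquiv L c N H v (evalPlace (↥(maximalRealSubfield L)) L c N H v b))) b =
      Λ' (e b) := by
    intro b
    have hiff : b ∈ {b : finAdelic (↥(maximalRealSubfield L)) L c N H |
        ∀ v ∉ S, evalPlace (↥(maximalRealSubfield L)) L c N H v b ∈ localInt L c N H v} ↔
        e b ∈ rpBox (fun v => (B v : Set (G v))) S := Iff.rfl
    by_cases hb : b ∈ {b : finAdelic (↥(maximalRealSubfield L)) L c N H |
        ∀ v ∉ S, evalPlace (↥(maximalRealSubfield L)) L c N H v b ∈ localInt L c N H v}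
    · simp only [Λ', Set.indicator_of_mem hb, Set.indicator_of_mem (hiff.1 hb)]
      rw [← Finset.prod_coe_sort S]
      rfl
    · simp only [Λ', Set.indicator_of_notMem hb, Set.indicator_of_notMem (fun h => hb (hiff.2 h))]
  -- transport to the restricted product, rescale, Euler factorise
  have h1 : ∫ b, Λ' (e b) ∂μf = ∫ x, Λ' x ∂μ' :=
    (integral_map_equiv e.toHomeomorph.toMeasurableEquiv Λ').symm
  have h2 : ∫ x, Λ' x ∂μ' = ((κ.toReal : ℝ) : ℂ) * ∫ x, Λ' x ∂(rpMeasure (fun v => (B v : Set (G v))) ν' ∅) := by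
    rw [key, integral_smul_measure, Complex.real_smul]
  have h3 : ∫ x, Λ' x ∂(rpMeasure (fun v => (B v : Set (G v))) ν' ∅) =
      ∏ i : {i // i ∈ S}, ∫ y, f i.1 (ψ i.1 y) ∂(ν' i.1) :=
    integral_indicator_rpBox_prod (fun v => (B v : Set (G v))) ν' (fun v => ⟨1, (B v).one_mem⟩) hBm
      (S₀ := ∅) hB1 (Finset.empty_subset S) (fun i : {i // i ∈ S} => fun y => f i.1 (ψ i.1 y))
  have h4 : ∀ v, ∫ y, f v (ψ v y) ∂(ν' v) = ∫ x, f v x ∂(m v) := fun v => by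
    have h := integral_map_equiv (μ := m v) (ψ v).symm.toHomeomorph.toMeasurableEquiv (fun y => f v (ψ v y))
    refine h.trans (integral_congr_ae (Eventually.of_forall fun x => ?_))
    change f v (ψ v ((ψ v).symm x)) = f v x
    rw [ContinuousMulEquiv.apply_symm_apply]
  refine (integral_congr_ae (Eventually.of_forall hΛ)).trans ?_
  rw [h1, h2, h3]
  congr 1
  rw [← Finset.prod_coe_sort S (fun v => ∫ x, f v x ∂(m v))]
  exact Finset.prod_congr rfl fun i _ => h4 i.1

/-- **Euler factorisation of the integral of a pure tensor on `U(H)(𝔸_{L⁺})`.** For Haar measures `ν` on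
`U(H)(𝔸_{L⁺})`, `μ_∞` on `U(H)(L⁺ ⊗ ℝ)` and local Haar measures `m_v` on the `U(H)(L⁺_v)` normalised by
`m_v(U(H)(𝒪_v)) = 1`, there is ONE `κ > 0` such that for every pure tensor `T` whose levels off its bad set `S` are
the integral levels, `∫ T.eval dν = κ · (∫ f_∞ dμ_∞) · ∏_{v ∈ S} ∫ f_v dm_v` (no integrability hypotheses).
[cite: BorelJacquet1979, §4.1] -/
theorem exists_integral_eval_eq_mul_integral_arch_mul_prod
    [MeasurableSpace (adelic (↥(maximalRealSubfield L)) L (IsCMField.complexConj L) N H)]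
    [BorelSpace (adelic (↥(maximalRealSubfield L)) L (IsCMField.complexConj L) N H)]
    [MeasurableSpace (UnitaryGroup.arch (↥(maximalRealSubfield L)) L (IsCMField.complexConj L) N H)]
    [BorelSpace (UnitaryGroup.arch (↥(maximalRealSubfield L)) L (IsCMField.complexConj L) N H)]
    [∀ v, MeasurableSpace ((cmDatum L N H).Local v)] [∀ v, BorelSpace ((cmDatum L N H).Local v)]
    (ν : Measure (adelic (↥(maximalRealSubfield L)) L (IsCMField.complexConj L) N H)) [ν.IsHaarMeasure]
    (μa : Measure (UnitaryGroup.arch (↥(maximalRealSubfield L)) L (IsCMField.complexConj L) N H)) [μa.IsHaarMeasure]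
    (m : ∀ v, Measure ((cmDatum L N H).Local v)) [∀ v, (m v).IsHaarMeasure]
    (hm : ∀ v, m v (cmLocalIntegralLevel L N H v) = 1) :
    ∃ κ : ℝ, 0 < κ ∧ ∀ (T : PureTensor L N H), (∀ v ∉ T.S, T.K v = cmLocalIntegralLevel L N H v) →
      ∫ g, T.eval g ∂ν = (κ : ℂ) * ((∫ a, T.arch a ∂μa) * ∏ v ∈ T.S, ∫ x, T.loc v x ∂(m v)) := by
  -- a Haar measure on the finite-adelic group (Borel structure = borel)
  letI : MeasurableSpace (finAdelic (↥(maximalRealSubfield L)) L (IsCMField.complexConj L) N H) := borel _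
  haveI : BorelSpace (finAdelic (↥(maximalRealSubfield L)) L (IsCMField.complexConj L) N H) := ⟨rfl⟩
  haveI := locallyCompactSpace_finAdelic (↥(maximalRealSubfield L)) L (IsCMField.complexConj L) N H
  let μf : Measure (finAdelic (↥(maximalRealSubfield L)) L (IsCMField.complexConj L) N H) := Measure.haar
  obtain ⟨κ₁, hκ₁, h₁⟩ :=
    PureTensor.exists_integral_eval_eq_mul_integral_arch_mul_integral_finFactor (L := L) (N := N) (H := H) ν μa μf
  obtain ⟨κ₂, hκ₂, h₂⟩ := exists_integral_finFactor_eq_mul_prod (L := L) (N := N) (H := H) μf m hm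
  refine ⟨κ₁ * κ₂, mul_pos (NNReal.coe_pos.2 hκ₁) hκ₂, fun T hK => ?_⟩
  rw [h₁ T hK, h₂ T.S T.loc]
  push_cast
  ring

end CM

end Literature.NumberTheory.Automorphic.UnitaryGroup

end
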